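import Literature.NumberTheory.Automorphic.SiegelReducedFamilies
import Literature.Analysis.Calculus.WeightedTameFunctions
import Mathlib.Analysis.Complex.Basic
import HarnessLib

/-!
# Smooth cut-offs of Siegel-reduced families with tame derivative bounds

Topic `NumberTheory/Automorphic`; namespace `Literature.NumberTheory.Automorphic`, grouping
sub-namespace `SiegelFamily`.  Theorems only; sequel to `SiegelReducedFamilies` (the recursive
description `SiegelFamily.IsReduced c C τ m H` of the image of an archimedean Siegel set in the cone
of positive forms, peeling the last index through the Schur complement `SiegelFamily.schur`).

Borel glues local primitives on the symmetric space of an arithmetic group with a `Γ`-partition of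
unity subordinate to translates of Siegel sets whose derivatives grow moderately
([Borel1969, §12–§13]; [Borel1983Regularization, §3.5]).  The building block is a smooth CUT-OFF
of a reduced set: for reduction constants `c < c'`, `C < C'`, `τ < τ'` (`0 < c`) and a *tame* family
`G : X → ι → Matrix (Fin m) (Fin m) ℂ` of positive definite matrices on an open set `U` (entries
`C^∞` on `U` with derivatives of order `≤ 2` bounded by `C · B^k` for a weight `B ≥ 1`,
`Literature/Analysis/Calculus/WeightedTameFunctions.lean`) whose inverses have entries `≤ C · B^k`,
`SiegelFamily.exists_tame_cutoff` produces a tame `Φ : X → [0, 1]` with `Φ = 1` where `G` is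
`(c, C, τ)`-reduced and `Φ = 0` where `G` is not `(c', C', τ')`-reduced.

Construction (induction on `m`): the reduction conditions of the last index are the strict
inequalities `a_w / a_{w'} < C`, `‖G_w[j,m]‖² / a_w² < c²`, `a_w / Re (schur G)_w[m-1,m-1] < τ`
between tame functions, `a_w = Re G_w[m,m]` the pivots; `Φ` is the product of the smooth steps
`ρ ((q - r)/(q - p))` (`ρ = Real.smoothTransition`, `tame_smoothStep`) of these ratios `r` with the
cut-off of the Schur complement family.  Tameness of `1 / a_w` and of the Schur complement rests on
two facts on positive definite matrices: `1 ≤ Re M_ii · Re (M⁻¹)_ii`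
(`one_le_re_diag_mul_re_inv_diag`, the quadratic form at `e_i - t M⁻¹ e_i`), and: the Schur
complement of the last pivot is positive definite with inverse the leading block of `M⁻¹`
(`SiegelFamily.schur_posDef_and_inv_eq`, from the identity
`(M⁻¹)[<m,<m] · schur M = 1`, `SiegelFamily.inv_submatrix_mul_schur`) — so the pivots of all the
Schur levels are controlled by the entries of the inverses, which stay among those of `G⁻¹`.
Auxiliary: a real positive definite matrix is complex positive definite (`posDef_map_ofReal`),
inversion commutes with entrywise ring maps (`map_nonsing_inv_of_isUnit_det`).

## References

* A. Borel, *Introduction aux groupes arithmétiques*, Hermann (1969), §12–§13 [Borel1969].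
* A. Borel, *Regularization theorems in Lie algebra cohomology. Applications*, Duke Math. J. 50
  (1983), §3.5 [Borel1983Regularization].
-/

noncomputable section

open Set Literature.Analysis.Calculus
open scoped ComplexOrder Matrix ContDiff Topology

namespace Literature.NumberTheory.Automorphic

/-! ### Schur complements, inverses and pivots of positive definite matrices -/

/-- **Key identity**: for a positive definite `(m+1) × (m+1)` matrix, the leading `m × m` block of
the inverse is a left inverse of the Schur complement of the last pivot. [folklore] -/
theorem SiegelFamily.inv_submatrix_mul_schur {ι : Type*} {m : ℕ}
    (H : ι → Matrix (Fin (m + 1)) (Fin (m + 1)) ℂ) (w : ι) (hH : (H w).PosDef) :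
    ((H w)⁻¹).submatrix Fin.castSucc Fin.castSucc * SiegelFamily.schur H w = 1 := by
  have hd : H w (Fin.last m) (Fin.last m) ≠ 0 := (hH.diag_pos (i := Fin.last m)).ne'
  have hinv : (H w)⁻¹ * H w = 1 :=
    Matrix.nonsing_inv_mul _ ((Matrix.isUnit_iff_isUnit_det _).mp hH.isUnit)
  ext i j
  have h1 := congr_fun (congr_fun hinv i.castSucc) j.castSucc
  have h2 := congr_fun (congr_fun hinv i.castSucc) (Fin.last m)
  simp only [Matrix.mul_apply, Fin.sum_univ_castSucc, Matrix.one_apply, Fin.castSucc_inj,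
    Fin.castSucc_ne_last, if_false] at h1 h2
  have h3 : ∀ k : Fin m, ((H w)⁻¹).submatrix Fin.castSucc Fin.castSucc i k *
      SiegelFamily.schur H w k j = (H w)⁻¹ i.castSucc k.castSucc * H w k.castSucc j.castSucc -
        (H w)⁻¹ i.castSucc k.castSucc * H w k.castSucc (Fin.last m) *
          (H w (Fin.last m) j.castSucc / H w (Fin.last m) (Fin.last m)) := fun k => by
    simp only [Matrix.submatrix_apply, SiegelFamily.schur_apply]
    ring
  simp only [Matrix.mul_apply, h3, Finset.sum_sub_distrib, ← Finset.sum_mul, Matrix.one_apply]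
  rw [eq_sub_of_add_eq h1, eq_neg_of_add_eq_zero_left h2]
  field_simp
  ring

/-- For a positive definite `(m+1) × (m+1)` matrix: the Schur complement of the last pivot is
positive definite and its inverse is the leading block of the inverse. [folklore] -/
theorem SiegelFamily.schur_posDef_and_inv_eq {ι : Type*} {m : ℕ}
    (H : ι → Matrix (Fin (m + 1)) (Fin (m + 1)) ℂ) (w : ι) (hH : (H w).PosDef) :
    (SiegelFamily.schur H w).PosDef ∧
      (SiegelFamily.schur H w)⁻¹ = ((H w)⁻¹).submatrix Fin.castSucc Fin.castSucc := by
  have hkey := SiegelFamily.inv_submatrix_mul_schur H w hH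
  have hN : (((H w)⁻¹).submatrix Fin.castSucc Fin.castSucc).PosDef :=
    hH.inv.submatrix (Fin.castSucc_injective m)
  have hSinv : (SiegelFamily.schur H w)⁻¹ = ((H w)⁻¹).submatrix Fin.castSucc Fin.castSucc :=
    Matrix.inv_eq_left_inv hkey
  refine ⟨?_, hSinv⟩
  have hNinv : (((H w)⁻¹).submatrix Fin.castSucc Fin.castSucc)⁻¹ = SiegelFamily.schur H w :=
    Matrix.inv_eq_right_inv hkey
  rw [← hNinv]
  exact hN.inv

/-- **Pivot bound**: for a positive definite complex matrix `M`, `1 ≤ Re M_ii · Re (M⁻¹)_ii`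
(the quadratic form at `e_i - t M⁻¹ e_i`, `t = 1 / Re (M⁻¹)_ii`, is non-negative). [folklore] -/
theorem one_le_re_diag_mul_re_inv_diag {k : Type*} [Fintype k] [DecidableEq k]
    {M : Matrix k k ℂ} (hM : M.PosDef) (i : k) :
    1 ≤ (M i i).re * ((M⁻¹) i i).re := by
  have hU : IsUnit M.det := (Matrix.isUnit_iff_isUnit_det _).mp hM.isUnit
  have hNpd : (M⁻¹).PosDef := hM.inv
  have hν : 0 < ((M⁻¹) i i).re := (Complex.pos_iff.mp (hNpd.diag_pos (i := i))).1
  have hνim : ((M⁻¹) i i).im = 0 := (Complex.pos_iff.mp (hNpd.diag_pos (i := i))).2.symm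
  set e : k → ℂ := Pi.single i 1 with he
  set t : ℝ := (((M⁻¹) i i).re)⁻¹ with ht
  have hq := hM.posSemidef.dotProduct_mulVec_nonneg (e - (t : ℂ) • (M⁻¹ *ᵥ e))
  have hMNe : M *ᵥ (M⁻¹ *ᵥ e) = e := by
    rw [Matrix.mulVec_mulVec, Matrix.mul_nonsing_inv _ hU, Matrix.one_mulVec]
  have hee : star e ⬝ᵥ e = 1 := by simp [he]
  have heMe : star e ⬝ᵥ (M *ᵥ e) = M i i := by simp [he]
  have hNe_e : star (M⁻¹ *ᵥ e) ⬝ᵥ e = (M⁻¹) i i := by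
    rw [Matrix.star_mulVec, hNpd.1.eq, ← Matrix.dotProduct_mulVec]
    simp [he]
  have hNe_Me : star (M⁻¹ *ᵥ e) ⬝ᵥ (M *ᵥ e) = 1 := by
    rw [Matrix.star_mulVec, hNpd.1.eq, ← Matrix.dotProduct_mulVec, Matrix.mulVec_mulVec,
      Matrix.nonsing_inv_mul _ hU, Matrix.one_mulVec, hee]
  have hexp : star (e - (t : ℂ) • (M⁻¹ *ᵥ e)) ⬝ᵥ (M *ᵥ (e - (t : ℂ) • (M⁻¹ *ᵥ e))) =
      M i i - 2 * (t : ℂ) + (t : ℂ) ^ 2 * (M⁻¹) i i := by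
    rw [Matrix.mulVec_sub, Matrix.mulVec_smul, hMNe, star_sub, star_smul, sub_dotProduct,
      dotProduct_sub, dotProduct_sub, smul_dotProduct, smul_dotProduct, dotProduct_smul,
      dotProduct_smul, heMe, hee, hNe_Me, hNe_e, Complex.star_def, Complex.conj_ofReal]
    simp only [smul_eq_mul]
    ring
  rw [hexp] at hq
  have hre := (Complex.nonneg_iff.mp hq).1
  simp only [Complex.add_re, Complex.sub_re, Complex.mul_re, Complex.ofReal_re, Complex.ofReal_im,
    hνim, mul_zero, sub_zero, Complex.re_ofNat, Complex.im_ofNat] at hre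
  -- hre : 0 ≤ (M i i).re - 2 * t + (t^2).re * ν   (roughly)
  have ht2 : ((t : ℂ) ^ 2).re = t ^ 2 := by rw [← Complex.ofReal_pow, Complex.ofReal_re]
  rw [ht2] at hre
  have htν : t * ((M⁻¹) i i).re = 1 := inv_mul_cancel₀ hν.ne'
  nlinarith [htν, hre, hν]

/-- A real positive definite matrix is positive definite as a complex matrix. [folklore] -/
theorem posDef_map_ofReal {k : Type*} [Fintype k] [DecidableEq k] {A : Matrix k k ℝ}
    (hA : A.PosDef) : (A.map ((↑) : ℝ → ℂ)).PosDef := by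
  open scoped MatrixOrder in
  obtain ⟨B, hB⟩ := CStarAlgebra.nonneg_iff_eq_star_mul_self.mp hA.posSemidef.nonneg
  have hmap : A.map ((↑) : ℝ → ℂ) = (B.map ((↑) : ℝ → ℂ))ᴴ * B.map ((↑) : ℝ → ℂ) := by
    have h1 : A.map ((↑) : ℝ → ℂ) = (Bᴴ * B).map Complex.ofRealHom := by
      rw [hB, Matrix.star_eq_conjTranspose]; rfl
    rw [h1, Matrix.map_mul]
    congr 1
    rw [Matrix.conjTranspose_map]
    · rfl
    · intro a
      simp
  have hpsd : (A.map ((↑) : ℝ → ℂ)).PosSemidef := by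
    rw [hmap]
    exact Matrix.posSemidef_conjTranspose_mul_self _
  refine hpsd.posDef_iff_det_ne_zero.mpr ?_
  have hdet : (A.map ((↑) : ℝ → ℂ)).det = ((A.det : ℝ) : ℂ) := by
    have h := (RingHom.map_det Complex.ofRealHom A).symm
    rw [RingHom.mapMatrix_apply] at h
    exact h
  rw [hdet, Complex.ofReal_ne_zero]
  exact hA.det_pos.ne'

/-- Matrix inversion commutes with entrywise ring homomorphisms on matrices of unit determinant.
[folklore] -/
theorem map_nonsing_inv_of_isUnit_det {k R S : Type*} [Fintype k] [DecidableEq k] [CommRing R]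
    [CommRing S] (f : R →+* S) {M : Matrix k k R} (hM : IsUnit M.det) :
    (M⁻¹).map f = (M.map f)⁻¹ := by
  symm
  apply Matrix.inv_eq_left_inv
  rw [← Matrix.map_mul, Matrix.nonsing_inv_mul _ hM, Matrix.map_one _ (map_zero f) (map_one f)]

/-! ### Smooth steps and values in `[0, 1]` -/

section Steps

variable {X : Type*} [NormedAddCommGroup X] [NormedSpace ℝ X] {U : Set X} {B : X → ℝ}

/-- Values in `[0, 1]` are stable under products. [folklore] -/
theorem unitBound_mul {u v : ℝ} (hu : 0 ≤ u ∧ u ≤ 1) (hv : 0 ≤ v ∧ v ≤ 1) :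
    0 ≤ u * v ∧ u * v ≤ 1 :=
  ⟨mul_nonneg hu.1 hv.1, mul_le_one₀ hu.2 hv.1 hv.2⟩

/-- Values in `[0, 1]` are stable under finite products. [folklore] -/
theorem unitBound_prod {κ : Type*} (s : Finset κ) {f : κ → ℝ}
    (h : ∀ a ∈ s, 0 ≤ f a ∧ f a ≤ 1) : 0 ≤ ∏ a ∈ s, f a ∧ ∏ a ∈ s, f a ≤ 1 :=
  ⟨Finset.prod_nonneg fun a ha => (h a ha).1,
    Finset.prod_le_one (fun a ha => (h a ha).1) fun a ha => (h a ha).2⟩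

/-- The smooth comparison `‖z‖² / a² < κ²` is the reduction inequality `‖z‖ < κ a`. [folklore] -/
theorem normSq_mul_inv_sq_lt_iff {z : ℂ} {a κ : ℝ} (ha : 0 < a) (hκ : 0 < κ) :
    (z.re * z.re + z.im * z.im) * (a⁻¹ * a⁻¹) < κ ^ 2 ↔ ‖z‖ < κ * a := by
  have h1 : (z.re * z.re + z.im * z.im) * (a⁻¹ * a⁻¹) = (‖z‖ / a) ^ 2 := by
    rw [← Complex.normSq_apply, Complex.normSq_eq_norm_sq]
    field_simp
  rw [h1, pow_lt_pow_iff_left₀ (div_nonneg (norm_nonneg z) ha.le) hκ.le two_ne_zero,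
    div_lt_iff₀ ha]

/-- **Smooth steps.** For thresholds `p < q` and a tame real function `r`, the function
`x ↦ ρ ((q - r x) / (q - p))` (`ρ = Real.smoothTransition`) is tame, takes values in `[0, 1]`,
equals `1` where `r < p` and vanishes where `q ≤ r`. [folklore] -/
theorem tame_smoothStep (hU : IsOpen U) (hB : ∀ x ∈ U, 1 ≤ B x) {p q : ℝ} (hpq : p < q) {r : X → ℝ}
    (hr : ContDiffOn ℝ ∞ r U ∧ ∃ (C : ℝ) (k : ℕ), ∀ x ∈ U, ∀ i ≤ 2,
      ‖iteratedFDerivWithin ℝ i r U x‖ ≤ C * B x ^ k) :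
    (ContDiffOn ℝ ∞ (fun x => Real.smoothTransition ((q - r x) * (q - p)⁻¹)) U ∧
      ∃ (C : ℝ) (k : ℕ), ∀ x ∈ U, ∀ i ≤ 2,
        ‖iteratedFDerivWithin ℝ i (fun x => Real.smoothTransition ((q - r x) * (q - p)⁻¹)) U x‖ ≤
          C * B x ^ k) ∧
    (∀ x, 0 ≤ Real.smoothTransition ((q - r x) * (q - p)⁻¹) ∧
      Real.smoothTransition ((q - r x) * (q - p)⁻¹) ≤ 1) ∧
    (∀ x, r x < p → Real.smoothTransition ((q - r x) * (q - p)⁻¹) = 1) ∧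
    (∀ x, Real.smoothTransition ((q - r x) * (q - p)⁻¹) ≠ 0 → r x < q) := by
  have hqp : 0 < q - p := sub_pos.mpr hpq
  refine ⟨?_, fun x => ⟨Real.smoothTransition.nonneg _, Real.smoothTransition.le_one _⟩,
    fun x hx => ?_, fun x hx => ?_⟩
  · exact tame_smoothTransition hU hB
      (tame_mul hU hB (tame_sub hU hB (tame_const hB q) hr)
        (tame_const hB (q - p)⁻¹))
  · refine Real.smoothTransition.one_of_one_le ?_
    rw [← div_eq_mul_inv, one_le_div hqp]
    linarith
  · by_contra hge
    refine hx (Real.smoothTransition.zero_of_nonpos ?_)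
    rw [← div_eq_mul_inv]
    exact div_nonpos_iff.mpr (Or.inr ⟨by linarith [not_lt.mp hge], hqp.le⟩)

end Steps

/-! ### The recursive cut-off: induction on the size of the matrices -/

section Induction

variable {X : Type*} [NormedAddCommGroup X] [NormedSpace ℝ X] {U : Set X} {B : X → ℝ}

/-- **Pivot package.** For a tame family of positive definite matrices whose inverses have
polynomially bounded entries: a diagonal entry is a positive real, its real part is tame, and the
inverse of its real part is tame (`Re M_ii ≥ 1 / Re (M⁻¹)_ii`). [folklore] -/
theorem SiegelFamily.tame_pivot_package (hU : IsOpen U) (hB : ∀ x ∈ U, 1 ≤ B x) {ι : Type*}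
    {m : ℕ} {G : X → ι → Matrix (Fin m) (Fin m) ℂ}
    (hG : ∀ w i j, ContDiffOn ℝ ∞ (fun x => G x w i j) U ∧ ∃ (C : ℝ) (k : ℕ), ∀ x ∈ U, ∀ l ≤ 2,
      ‖iteratedFDerivWithin ℝ l (fun x => G x w i j) U x‖ ≤ C * B x ^ k)
    (hpd : ∀ x ∈ U, ∀ w, (G x w).PosDef)
    (hinv : ∃ (C : ℝ) (k : ℕ), ∀ x ∈ U, ∀ w i j, ‖(G x w)⁻¹ i j‖ ≤ C * B x ^ k)
    (w : ι) (i : Fin m) :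
    (∀ x ∈ U, 0 < (G x w i i).re) ∧
    (∀ x ∈ U, G x w i i = (((G x w i i).re : ℝ) : ℂ)) ∧
    (ContDiffOn ℝ ∞ (fun x => (G x w i i).re) U ∧ ∃ (C : ℝ) (k : ℕ), ∀ x ∈ U, ∀ l ≤ 2,
      ‖iteratedFDerivWithin ℝ l (fun x => (G x w i i).re) U x‖ ≤ C * B x ^ k) ∧
    (ContDiffOn ℝ ∞ (fun x => ((G x w i i).re)⁻¹) U ∧ ∃ (C : ℝ) (k : ℕ), ∀ x ∈ U, ∀ l ≤ 2,
      ‖iteratedFDerivWithin ℝ l (fun x => ((G x w i i).re)⁻¹) U x‖ ≤ C * B x ^ k) := by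
  have hpos : ∀ x ∈ U, 0 < (G x w i i).re := fun x hx =>
    (Complex.pos_iff.mp ((hpd x hx w).diag_pos (i := i))).1
  have hreal : ∀ x ∈ U, G x w i i = (((G x w i i).re : ℝ) : ℂ) := fun x hx => by
    have him : (G x w i i).im = 0 :=
      ((Complex.pos_iff.mp ((hpd x hx w).diag_pos (i := i))).2).symm
    exact Complex.ext (by simp) (by simp [him])
  have hre : ContDiffOn ℝ ∞ (fun x => (G x w i i).re) U ∧ ∃ (C : ℝ) (k : ℕ), ∀ x ∈ U, ∀ l ≤ 2,
      ‖iteratedFDerivWithin ℝ l (fun x => (G x w i i).re) U x‖ ≤ C * B x ^ k :=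
    tame_clm_comp hU Complex.reCLM (hG w i i)
  refine ⟨hpos, hreal, hre, ?_⟩
  obtain ⟨C, k, hC⟩ := hinv
  refine tame_inv hU hB hpos (Ci := C) (ki := k) (fun x hx => ?_) hre
  have h1 := one_le_re_diag_mul_re_inv_diag (hpd x hx w) i
  have ha := hpos x hx
  calc ((G x w i i).re)⁻¹ = ((G x w i i).re)⁻¹ * 1 := (mul_one _).symm
    _ ≤ ((G x w i i).re)⁻¹ * ((G x w i i).re * ((G x w)⁻¹ i i).re) :=
        mul_le_mul_of_nonneg_left h1 (inv_nonneg.mpr ha.le)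
    _ = ((G x w)⁻¹ i i).re := by rw [← mul_assoc, inv_mul_cancel₀ ha.ne', one_mul]
    _ ≤ ‖(G x w)⁻¹ i i‖ := Complex.re_le_norm _
    _ ≤ C * B x ^ k := hC x hx w i i

/-- **The recursive cut-off (induction on the size).**  For a tame family `G` of positive definite
matrices on `U` with polynomially bounded inverses there is a tame `Φ : X → [0, 1]`, equal to `1`
where `G` is `(c, C, τ)`-reduced and vanishing where `G` is not `(c', C', τ')`-reduced: the product
of the smooth steps of the finitely many reduction inequalities of the last index and of the
cut-off of the Schur complement family (induction hypothesis; the Schur complement of a positive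
definite matrix is positive definite with inverse a block of the inverse).
[cite: Borel1969, §12–§13] -/
theorem SiegelFamily.exists_tame_cutoff (hU : IsOpen U) (hB : ∀ x ∈ U, 1 ≤ B x) {ι : Type*}
    [Fintype ι] {c C τ c' C' τ' : ℝ} (hc : 0 < c) (hcc' : c < c') (hCC' : C < C')
    (hττ' : τ < τ') :
    ∀ (m : ℕ) (G : X → ι → Matrix (Fin m) (Fin m) ℂ),
      (∀ w i j, ContDiffOn ℝ ∞ (fun x => G x w i j) U ∧ ∃ (C₀ : ℝ) (k : ℕ), ∀ x ∈ U, ∀ l ≤ 2,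
        ‖iteratedFDerivWithin ℝ l (fun x => G x w i j) U x‖ ≤ C₀ * B x ^ k) →
      (∀ x ∈ U, ∀ w, (G x w).PosDef) →
      (∃ (C₀ : ℝ) (k : ℕ), ∀ x ∈ U, ∀ w i j, ‖(G x w)⁻¹ i j‖ ≤ C₀ * B x ^ k) →
      ∃ Φ : X → ℝ,
        (ContDiffOn ℝ ∞ Φ U ∧ ∃ (C₀ : ℝ) (k : ℕ), ∀ x ∈ U, ∀ l ≤ 2,
          ‖iteratedFDerivWithin ℝ l Φ U x‖ ≤ C₀ * B x ^ k) ∧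
        (∀ x ∈ U, 0 ≤ Φ x ∧ Φ x ≤ 1) ∧
        (∀ x ∈ U, SiegelFamily.IsReduced c C τ m (G x) → Φ x = 1) ∧
        (∀ x ∈ U, Φ x ≠ 0 → SiegelFamily.IsReduced c' C' τ' m (G x)) := by
  intro m
  induction m with
  | zero =>
    intro G _ _ _
    exact ⟨fun _ => 1, tame_const hB 1, fun x _ => ⟨zero_le_one, le_rfl⟩, fun _ _ _ => rfl,
      fun _ _ _ => trivial⟩
  | succ m ih =>
    intro G hG hpd hinv
    have hc' : 0 < c' := hc.trans hcc'
    have hcc2 : c ^ 2 < c' ^ 2 := pow_lt_pow_left₀ hcc' hc.le two_ne_zero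
    -- pivots of the last index
    have hP := fun w => SiegelFamily.tame_pivot_package hU hB hG hpd hinv w (Fin.last m)
    -- the Schur complement family
    have hpd' : ∀ x ∈ U, ∀ w, (SiegelFamily.schur (G x) w).PosDef := fun x hx w =>
      (SiegelFamily.schur_posDef_and_inv_eq (G x) w (hpd x hx w)).1
    have hinv' : ∃ (C₀ : ℝ) (k : ℕ), ∀ x ∈ U, ∀ w i j,
        ‖(SiegelFamily.schur (G x) w)⁻¹ i j‖ ≤ C₀ * B x ^ k := by
      obtain ⟨C₀, k, h⟩ := hinv
      refine ⟨C₀, k, fun x hx w i j => ?_⟩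
      rw [(SiegelFamily.schur_posDef_and_inv_eq (G x) w (hpd x hx w)).2, Matrix.submatrix_apply]
      exact h x hx w _ _
    have hG' : ∀ w i j, ContDiffOn ℝ ∞ (fun x => SiegelFamily.schur (G x) w i j) U ∧
        ∃ (C₀ : ℝ) (k : ℕ), ∀ x ∈ U, ∀ l ≤ 2,
          ‖iteratedFDerivWithin ℝ l (fun x => SiegelFamily.schur (G x) w i j) U x‖ ≤
            C₀ * B x ^ k := by
      intro w i j
      have h := tame_sub hU hB (hG w i.castSucc j.castSucc)
        (tame_mul hU hB
          (tame_mul hU hB (hG w i.castSucc (Fin.last m)) (hG w (Fin.last m) j.castSucc))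
          (tame_clm_comp hU Complex.ofRealCLM (hP w).2.2.2))
      refine tame_congr hU (fun x hx => ?_) h
      simp only [SiegelFamily.schur_apply, Complex.ofRealCLM_apply, Complex.ofReal_inv]
      rw [← (hP w).2.1 x hx, div_eq_mul_inv]
    obtain ⟨Φ', hΦ't, hΦ'01, hΦ'1, hΦ'0⟩ := ih (fun x => SiegelFamily.schur (G x)) hG' hpd' hinv'
    -- pivots of the Schur complement family (all diagonal entries)
    have hP' := fun w j => SiegelFamily.tame_pivot_package hU hB hG' hpd' hinv' w j
    -- the three families of smooth steps
    have hS1 := fun p : ι × ι => tame_smoothStep hU hB hCC'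
      (tame_mul hU hB (hP p.1).2.2.1 (hP p.2).2.2.2)
    have hS2 := fun q : ι × Fin m => tame_smoothStep hU hB hcc2
      (tame_mul hU hB
        (tame_add hU hB
          (tame_mul hU hB
            (tame_clm_comp hU Complex.reCLM (hG q.1 q.2.castSucc (Fin.last m)))
            (tame_clm_comp hU Complex.reCLM (hG q.1 q.2.castSucc (Fin.last m))))
          (tame_mul hU hB
            (tame_clm_comp hU Complex.imCLM (hG q.1 q.2.castSucc (Fin.last m)))
            (tame_clm_comp hU Complex.imCLM (hG q.1 q.2.castSucc (Fin.last m)))))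
        (tame_mul hU hB (hP q.1).2.2.2 (hP q.1).2.2.2))
    have hS3 := fun q : ι × Fin m => tame_smoothStep hU hB hττ'
      (tame_mul hU hB (hP q.1).2.2.1 (hP' q.1 q.2).2.2.2)
    -- the index set of the ratio conditions
    set S3 : Finset (ι × Fin m) :=
      (Finset.univ : Finset ι) ×ˢ (Finset.univ.filter fun j : Fin m => (j : ℕ) + 1 = m) with hS3_def
    have hmemS3 : ∀ (w : ι) (j : Fin m), (j : ℕ) + 1 = m → (w, j) ∈ S3 := fun w j hj => by
      simp [hS3_def, hj]
    -- the products
    have hT1 :=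
      tame_finset_prod hU hB (Finset.univ : Finset (ι × ι)) fun p _ => (hS1 p).1
    have hT2 :=
      tame_finset_prod hU hB (Finset.univ : Finset (ι × Fin m)) fun q _ => (hS2 q).1
    have hT3 := tame_finset_prod hU hB S3 fun q _ => (hS3 q).1
    have hT := tame_mul hU hB hT1
      (tame_mul hU hB hT2 (tame_mul hU hB hT3 hΦ't))
    refine ⟨_, hT, fun x hx => ?_, fun x hx hred => ?_, fun x hx hne => ?_⟩
    · -- values in `[0, 1]`
      exact unitBound_mul (unitBound_prod _ fun p _ => (hS1 p).2.1 x)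
        (unitBound_mul (unitBound_prod _ fun q _ => (hS2 q).2.1 x)
          (unitBound_mul (unitBound_prod _ fun q _ => (hS3 q).2.1 x) (hΦ'01 x hx)))
    · -- `= 1` on reduced families
      obtain ⟨-, hpos, hcross, hcol, hratio, hsch⟩ := hred
      have e1 : ∀ p : ι × ι, Real.smoothTransition ((C' - (G x p.1 (Fin.last m) (Fin.last m)).re *
          ((G x p.2 (Fin.last m) (Fin.last m)).re)⁻¹) * (C' - C)⁻¹) = 1 := fun p =>
        (hS1 p).2.2.1 x ((mul_inv_lt_iff₀ ((hP p.2).1 x hx)).mpr (hcross p.1 p.2))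
      have e2 : ∀ q : ι × Fin m, Real.smoothTransition ((c' ^ 2 -
          ((G x q.1 q.2.castSucc (Fin.last m)).re * (G x q.1 q.2.castSucc (Fin.last m)).re +
            (G x q.1 q.2.castSucc (Fin.last m)).im * (G x q.1 q.2.castSucc (Fin.last m)).im) *
          (((G x q.1 (Fin.last m) (Fin.last m)).re)⁻¹ *
            ((G x q.1 (Fin.last m) (Fin.last m)).re)⁻¹)) *
            (c' ^ 2 - c ^ 2)⁻¹) = 1 := fun q =>
        (hS2 q).2.2.1 x ((normSq_mul_inv_sq_lt_iff ((hP q.1).1 x hx) hc).mpr (hcol q.1 q.2))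
      have e3 : ∀ q ∈ S3, Real.smoothTransition ((τ' - (G x q.1 (Fin.last m) (Fin.last m)).re *
          ((SiegelFamily.schur (G x) q.1 q.2 q.2).re)⁻¹) * (τ' - τ)⁻¹) = 1 := fun q hq => by
        have hj : ((q.2 : Fin m) : ℕ) + 1 = m := by
          simp only [hS3_def, Finset.mem_product, Finset.mem_univ, Finset.mem_filter,
            true_and] at hq
          exact hq
        exact (hS3 q).2.2.1 x ((mul_inv_lt_iff₀ ((hP' q.1 q.2).1 x hx)).mpr (hratio q.1 q.2 hj))
      have e4 : Φ' x = 1 := hΦ'1 x hx hsch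
      simp only [Complex.reCLM_apply, Complex.imCLM_apply]
      rw [Finset.prod_eq_one fun p _ => e1 p, Finset.prod_eq_one fun q _ => e2 q,
        Finset.prod_eq_one e3, e4, mul_one, mul_one, mul_one]
    · -- `≠ 0` forces reducedness with the larger constants
      simp only [mul_ne_zero_iff] at hne  -- hne : A ≠ 0 ∧ B ≠ 0 ∧ C ≠ 0 ∧ Φ' x ≠ 0
      obtain ⟨h1, h2, h3, h4⟩ := hne
      rw [Finset.prod_ne_zero_iff] at h1 h2 h3
      refine ⟨fun w => (hpd x hx w).1, fun w => (hP w).1 x hx, fun w w' => ?_, fun w j => ?_,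
        fun w j hj => ?_, hΦ'0 x hx h4⟩
      · exact (mul_inv_lt_iff₀ ((hP w').1 x hx)).mp
          ((hS1 (w, w')).2.2.2 x (h1 (w, w') (Finset.mem_univ _)))
      · exact (normSq_mul_inv_sq_lt_iff ((hP w).1 x hx) hc').mp
          ((hS2 (w, j)).2.2.2 x (h2 (w, j) (Finset.mem_univ _)))
      · exact (mul_inv_lt_iff₀ ((hP' w j).1 x hx)).mp
          ((hS3 (w, j)).2.2.2 x (h3 (w, j) (hmemS3 w j hj)))

end Induction

end Literature.NumberTheory.Automorphic
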